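import Summits.QuantumFields.YangMills.Theorems.FemtoTransferGapAdjoint

/-!
# Femto transfer gap — the adjoint-action dictionary, II: zero-mode coordinates, toron symmetrisation, `S = 8·V_Lüscher`

Sequel of `FemtoTransferGapAdjoint` (cell `ym-beyond`, seat P1; route `LuscherReduction`, crux `OneSiteLevels` =
`stmt-QuantumFields-20007`; consumed by the energy stubs `stub_absUpper` / `stub_absLower`).  This file:

* §3 the zero-mode coordinates `zmCoord lam U : ZM`, `x_{(i,a)} = vecPart(U_i)_a / lam`, with
  `zmCoord lam (V U V⁻¹) = colourRotate (adRot V) (zmCoord lam U)` — so every colour-rotation invariant `F : ZM → ℝ` pulls back to a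
  conjugation-invariant function of the links (the one-site Gauss law: `pullback_conj`) — and the TORON SYMMETRISATION
  `toronSym ψ (U) = Σ_{S ⊆ {0,1,2}} ψ(((−1)^{[i∈S]} U_i)_i)`, which makes it zero-flux: `isPhys_of_invariant`, `isPhys_toronSym`,
  `isPhys_toronSym_pullback` (continuous bounded colour-rotation invariant `F` ⇒ `IsPhys (toronSym (F ∘ zmCoord lam))`);
* §4 the one-site Wilson action IS `8 · luscherPotential` of the vector coordinates, ON THE NOSE:
  `wilsonAction su2Rep U = 8 * luscherPotential (zmCoord 1 U)` (`wilsonAction_one_site_eq_luscherPotential`); quartic scaling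
  `luscherPotential (zmCoord lam U) = luscherPotential (zmCoord 1 U) / lam⁴`; and at the scale `B lam³ = 2` the kernel's magnetic
  exponent is `(B/2) S(U) = 8 lam · luscherPotential (zmCoord lam U)` (`half_mul_wilsonAction_eq`) — linear in `lam = λ_b`, exactly
  the `λ_b 𝔥` scaling; plus the sharpened near-vacuum bound `S(U) ≤ 3 t⁴` (`wilsonAction_le_three_mul_pow`);
* §5 the zero-mode chart `zmChart lam x = (chartSU2 (lam · x_i))_i : Cfg` with `zmCoord lam (zmChart lam x) = x` (`|lam x_i| ≤ 1`) and
  `zmChart lam (zmCoord lam U) = U` (links in the hemisphere `u₀ ≥ 0`), continuity — the push-forward direction for trial functions.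

## WHAT THIS IS NOT
Not a proof of either energy stub and NOT THE CLAY GAP: finite-dimensional (`L = 1`) bookkeeping, no limit, no spectral
statement.  Everything below is proved (no `sorry`, no new axiom).
-/

set_option autoImplicit false

noncomputable section

open MeasureTheory Filter Topology Real
open scoped Matrix ComplexConjugate Quaternion
open Literature.MathematicalPhysics.QuantumFieldTheory
open Literature.MathematicalPhysics.QuantumLattice
open Literature.Analysis.OperatorTheory.YMMatrixModel

namespace Summit.QuantumFields.YangMills.Theorems.FemtoTransferGap

/-! ### §3. Zero-mode coordinates of a one-site configuration; physical pull-backs by toron symmetrisation -/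

/-- The link in direction `i` of the one-site lattice. [folklore] -/
def edgeOf (i : Fin 3) : Edge 3 1 := (0, i)

/-- Every link of the one-site lattice is `edgeOf` of its direction. [folklore] -/
theorem edgeOf_snd (e : Edge 3 1) : edgeOf e.2 = e := by
  unfold edgeOf
  ext1
  · exact Subsingleton.elim _ _
  · rfl

/-- On one site every link is `edgeOf` of its direction: `U (x, i) = U (edgeOf i)`. [folklore] -/
theorem apply_site_eq (U : Cfg) (x : Site 3 1) (i : Fin 3) : U (x, i) = U (edgeOf i) :=
  congrArg U (Prod.ext (Subsingleton.elim _ _) rfl)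

/-- The zero-mode coordinates `x_{(i,a)} = vecPart(U_i)_a / lam` of a one-site configuration (the three colour vectors of the
matrix model `YMMatrixModel`, read off in the quaternion chart at scale `lam`). [cite: Luscher1983, §2] [cite: Vanbaal2001, §4] -/
def zmCoord (lam : ℝ) (U : Cfg) : ZM :=
  WithLp.toLp 2 fun p : Fin 3 × Fin 3 => vecPart (U (edgeOf p.1)) p.2 / lam

/-- Coordinates of `zmCoord`. [folklore] -/
@[simp] theorem zmCoord_apply (lam : ℝ) (U : Cfg) (p : Fin 3 × Fin 3) :
    zmCoord lam U p = vecPart (U (edgeOf p.1)) p.2 / lam := rfl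

/-- The colour vectors of `zmCoord lam U` are the scaled vector parts of the links. [folklore] -/
theorem colourVec_zmCoord (lam : ℝ) (U : Cfg) (i : Fin 3) :
    colourVec (zmCoord lam U) i = fun a => vecPart (U (edgeOf i)) a / lam := rfl

/-- **Simultaneous conjugation of the links rotates the zero-mode coordinates by `Ad(V)`.** [cite: Vanbaal2001, §4] -/
theorem zmCoord_conj (lam : ℝ) (V : SU2) (U : Cfg) :
    zmCoord lam (fun e => V * U e * V⁻¹) = colourRotate (adRot V) (zmCoord lam U) := by
  ext p
  rw [zmCoord_apply, vecPart_conj, Matrix.mulVec, dotProduct]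
  show _ = ∑ b : Fin 3, adRot V p.2 b * zmCoord lam U (p.1, b)
  simp only [zmCoord_apply]
  rw [Finset.sum_div]
  refine Finset.sum_congr rfl fun b _ => ?_
  ring

/-- `zmCoord` is continuous in the configuration. [folklore] -/
theorem continuous_zmCoord (lam : ℝ) : Continuous (zmCoord lam) := by
  refine (PiLp.continuous_toLp 2 _).comp ?_
  refine continuous_pi fun p => ?_
  have h1 : Continuous fun U : Cfg => U (edgeOf p.1) := continuous_apply (edgeOf p.1)
  have h2 : Continuous fun U : Cfg => vecPart (U (edgeOf p.1)) p.2 := (continuous_apply p.2).comp (continuous_vecPart.comp h1)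
  exact h2.div_const lam

/-- A colour-rotation invariant function of the zero modes, pulled back to the links, is invariant under simultaneous
conjugation (the one-site Gauss law). [cite: Vanbaal2001, §4] -/
theorem pullback_conj {F : ZM → ℝ} (hF : IsGaugeInv F) (lam : ℝ) (V : SU2) (U : Cfg) :
    F (zmCoord lam (fun e => V * U e * V⁻¹)) = F (zmCoord lam U) := by
  rw [zmCoord_conj]
  exact hF _ (adRot_mem_specialOrthogonalGroup V) _

/-- On one site a gauge transformation is simultaneous conjugation by `g 0`. [folklore] -/
theorem gaugeTransform_one_site_eq (g : Site 3 1 → SU2) (U : Cfg) : gaugeTransform g U = fun e => g 0 * U e * (g 0)⁻¹ := by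
  funext e
  rw [gaugeTransform_one_site, Subsingleton.elim e.1 0]

/-- On one site the twist through the plane `x_k = 0` multiplies the link in direction `k` by `z`. [folklore] -/
theorem twist_one_site (k : Fin 3) (z : SU2) (U : Cfg) : twist k z U = fun e => if e.2 = k then z * U e else U e := by
  funext e
  unfold twist
  have h0 : e.1 k = 0 := Subsingleton.elim _ _
  simp [h0]

/-- **Physical test functions from invariance**: a continuous bounded function of the one-site links, invariant under simultaneous
conjugation and under multiplying any one link by `−1`, is a physical zero-flux test function. [cite: Luscher1983, §2] -/
theorem isPhys_of_invariant {ψ : Cfg → ℝ} (hc : Continuous ψ) (hb : ∃ C : ℝ, ∀ U, |ψ U| ≤ C)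
    (hconj : ∀ (V : SU2) (U : Cfg), ψ (fun e => V * U e * V⁻¹) = ψ U)
    (hneg : ∀ (k : Fin 3) (U : Cfg), ψ (fun e => if e.2 = k then negOne * U e else U e) = ψ U) : IsPhys ψ where
  measurable := by
    haveI := secondCountableTopology_su2
    exact hc.measurable
  bounded := hb
  gaugeInv := fun g U => by rw [gaugeTransform_one_site_eq, hconj]
  zeroFlux := fun k z hz U => by
    rw [twist_one_site]
    rcases eq_one_or_eq_negOne_of_mem_center hz with rfl | rfl
    · simp
    · exact hneg k U

/-- **Toron symmetrisation**: the sum of `ψ` over the `8` centre translates `U ↦ ((−1)^{[i ∈ S]} U_i)_i`, `S ⊆ {0,1,2}`.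
[cite: Luscher1983, §3] [cite: Vanbaal2001, §4] -/
def toronSym (ψ : Cfg → ℝ) : Cfg → ℝ := fun U => ∑ S : Finset (Fin 3), ψ (fun e => if e.2 ∈ S then negOne * U e else U e)

/-- Toron symmetrisation is invariant under multiplying one link by `−1` (re-index `S ↦ S ∆ {k}`). [folklore] -/
theorem toronSym_neg (ψ : Cfg → ℝ) (k : Fin 3) (U : Cfg) :
    toronSym ψ (fun e => if e.2 = k then negOne * U e else U e) = toronSym ψ U := by
  unfold toronSym
  refine Finset.sum_bij (fun S _ => symmDiff S {k}) (fun _ _ => Finset.mem_univ _) (fun S₁ _ S₂ _ h => ?_) (fun S _ => ?_)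
    (fun S _ => ?_)
  · simpa using congrArg (fun T => symmDiff T {k}) h
  · exact ⟨symmDiff S {k}, Finset.mem_univ _, by simp⟩
  · congr 1
    funext e
    by_cases hk : e.2 = k
    · subst hk
      by_cases hS : e.2 ∈ S
      · have h1 : e.2 ∉ symmDiff S {e.2} := by simp [Finset.mem_symmDiff, hS]
        simp [hS, h1, ← mul_assoc]
      · have h1 : e.2 ∈ symmDiff S {e.2} := by simp [Finset.mem_symmDiff, hS]
        simp [hS, h1]
    · have h1 : (e.2 ∈ symmDiff S {k}) ↔ e.2 ∈ S := by simp [Finset.mem_symmDiff, hk]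
      by_cases hS : e.2 ∈ S
      · simp [hS, h1.2 hS, hk]
      · simp [hS, mt h1.1 hS, hk]

/-- Toron symmetrisation preserves conjugation invariance (`−1` is central). [folklore] -/
theorem toronSym_conj {ψ : Cfg → ℝ} (hconj : ∀ (V : SU2) (U : Cfg), ψ (fun e => V * U e * V⁻¹) = ψ U) (V : SU2) (U : Cfg) :
    toronSym ψ (fun e => V * U e * V⁻¹) = toronSym ψ U := by
  unfold toronSym
  refine Finset.sum_congr rfl fun S _ => ?_
  rw [← hconj V (fun e => if e.2 ∈ S then negOne * U e else U e)]
  congr 1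
  funext e
  split_ifs
  · rw [← mul_assoc, ← mul_assoc, negOne_mul_comm V, mul_assoc V negOne]
  · rfl

/-- Toron symmetrisation preserves continuity. [folklore] -/
theorem continuous_toronSym {ψ : Cfg → ℝ} (hc : Continuous ψ) : Continuous (toronSym ψ) := by
  refine continuous_finsetSum _ fun S _ => hc.comp ?_
  refine continuous_pi fun e => ?_
  split_ifs
  · exact (continuous_const.mul (continuous_apply e))
  · exact continuous_apply e

/-- Toron symmetrisation preserves boundedness (`8 C`). [folklore] -/
theorem toronSym_bounded {ψ : Cfg → ℝ} (hb : ∃ C : ℝ, ∀ U, |ψ U| ≤ C) : ∃ C : ℝ, ∀ U, |toronSym ψ U| ≤ C := by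
  obtain ⟨C, hC⟩ := hb
  refine ⟨∑ _S : Finset (Fin 3), C, fun U => ?_⟩
  exact (Finset.abs_sum_le_sum_abs _ _).trans (Finset.sum_le_sum fun S _ => hC _)

/-- **The physical pull-back**: for a continuous bounded conjugation-invariant `ψ`, its toron symmetrisation is a physical
zero-flux test function. [cite: Luscher1983, §3] [cite: Vanbaal2001, §4] -/
theorem isPhys_toronSym {ψ : Cfg → ℝ} (hc : Continuous ψ) (hb : ∃ C : ℝ, ∀ U, |ψ U| ≤ C)
    (hconj : ∀ (V : SU2) (U : Cfg), ψ (fun e => V * U e * V⁻¹) = ψ U) : IsPhys (toronSym ψ) :=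
  isPhys_of_invariant (continuous_toronSym hc) (toronSym_bounded hb) (toronSym_conj hconj) (toronSym_neg ψ)

/-- The toron-symmetrised pull-back of a continuous bounded colour-rotation invariant zero-mode function is physical.
[cite: Luscher1983, §3] [cite: Vanbaal2001, §4] -/
theorem isPhys_toronSym_pullback {F : ZM → ℝ} (hF : IsGaugeInv F) (hFc : Continuous F) (hFb : ∃ C : ℝ, ∀ x, |F x| ≤ C)
    (lam : ℝ) : IsPhys (toronSym fun U => F (zmCoord lam U)) :=
  isPhys_toronSym (hFc.comp (continuous_zmCoord lam)) (by obtain ⟨C, hC⟩ := hFb; exact ⟨C, fun U => hC _⟩)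
    (fun V U => pullback_conj hF lam V U)

/-- A product `χ · ψ` of a conjugation-invariant cut-off with a conjugation-invariant function is conjugation invariant (used with
`χ` a class function of the `vacDist`s / `scalarPart`s and `ψ = F ∘ zmCoord lam`). [folklore] -/
theorem mul_conj_invariant {χ ψ : Cfg → ℝ} (hχ : ∀ (V : SU2) (U : Cfg), χ (fun e => V * U e * V⁻¹) = χ U)
    (hψ : ∀ (V : SU2) (U : Cfg), ψ (fun e => V * U e * V⁻¹) = ψ U) (V : SU2) (U : Cfg) :
    (fun W => χ W * ψ W) (fun e => V * U e * V⁻¹) = (fun W => χ W * ψ W) U := by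
  simp only [hχ, hψ]

/-- Class-function cut-offs: any function of the scalar parts `(u₀(U_e))_e` is conjugation invariant. [folklore] -/
theorem scalarFun_conj {α : Type*} (G : (Edge 3 1 → ℝ) → α) (V : SU2) (U : Cfg) :
    G (fun e => scalarPart (V * U e * V⁻¹)) = G (fun e => scalarPart (U e)) := by
  simp only [scalarPart_conj]

/-! ### §4. The one-site Wilson action IS `8 · V_Lüscher` of the vector coordinates -/

/-- **`S(U) = 8 · luscherPotential (zmCoord 1 U)`**: `S(U) = Σ_{i<j} (2 − Re tr U_{ij}) = 4 Σ_{i<j} |u_i × u_j|²` and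
`luscherPotential x = ¼ Σ_{i,j} |x_i × x_j|² = ½ Σ_{i<j} |x_i × x_j|²`.  No approximation: the magnetic energy of the one-site model is
Lüscher's quartic zero-mode potential on the nose, in the coordinates `u_i = vecPart U_i`. [cite: Luscher1983, §2] [cite: Vanbaal2001, §4] -/
theorem wilsonAction_one_site_eq_luscherPotential (U : Cfg) : wilsonAction su2Rep U = 8 * luscherPotential (zmCoord 1 U) := by
  set f : Fin 3 → Fin 3 → ℝ := fun i j =>
    (vecPart (U (edgeOf i)) ⨯₃ vecPart (U (edgeOf j))) ⬝ᵥ (vecPart (U (edgeOf i)) ⨯₃ vecPart (U (edgeOf j))) with hf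
  have hsymm : ∀ i j, f j i = f i j := fun i j => by
    simp only [hf]
    rw [← cross_anticomm (vecPart (U (edgeOf i))) (vecPart (U (edgeOf j))), neg_dotProduct, dotProduct_neg, neg_neg]
  have hdiag : ∀ i, f i i = 0 := fun i => cross_dot_cross_self _
  -- left-hand side: the three plaquettes
  have hterm : ∀ p : Plaquette 3 1,
      (2 - (((U (p.1, p.2.1.1) * U (p.1, p.2.1.2) * (U (p.1, p.2.1.1))⁻¹ * (U (p.1, p.2.1.2))⁻¹ : SU2) :
        Matrix (Fin 2) (Fin 2) ℂ).trace).re) = 4 * f p.2.1.1 p.2.1.2 := by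
    intro p
    rw [apply_site_eq U p.1 p.2.1.1, apply_site_eq U p.1 p.2.1.2, two_sub_re_trace_comm_eq_cross]
  have hL : wilsonAction su2Rep U = 4 * (f 0 1 + f 0 2 + f 1 2) := by
    rw [wilsonAction_one_site, Finset.sum_congr rfl fun p _ => hterm p, Fintype.sum_prod_type, Fintype.sum_unique]
    have hsub : ∑ q : {p : Fin 3 × Fin 3 // p.1 < p.2}, f q.1.1 q.1.2 =
        ∑ q ∈ (Finset.univ : Finset (Fin 3 × Fin 3)).filter (fun p => p.1 < p.2), f q.1 q.2 :=
      (Finset.sum_subtype _ (fun q => by simp) (fun q : Fin 3 × Fin 3 => f q.1 q.2)).symm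
    rw [← Finset.mul_sum, hsub, Finset.sum_filter, Fintype.sum_prod_type]
    simp [Fin.sum_univ_three]
    try ring
  -- right-hand side: the nine ordered pairs
  have hR : luscherPotential (zmCoord 1 U) = (1 / 4 : ℝ) * ∑ i : Fin 3, ∑ j : Fin 3, f i j := by
    unfold luscherPotential
    congr 1
    refine Finset.sum_congr rfl fun i _ => Finset.sum_congr rfl fun j _ => ?_
    have hc : ∀ k, colourVec (zmCoord 1 U) k = vecPart (U (edgeOf k)) := fun k => by
      rw [colourVec_zmCoord]; funext a; simp
    rw [hc, hc]
  rw [hL, hR, Fin.sum_univ_three, Fin.sum_univ_three, Fin.sum_univ_three, Fin.sum_univ_three, hdiag, hdiag, hdiag,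
    hsymm 0 1, hsymm 0 2, hsymm 1 2]
  ring

/-- Scaling: `luscherPotential (zmCoord lam U) = luscherPotential (zmCoord 1 U) / lam⁴` (the potential is quartic). [folklore] -/
theorem luscherPotential_zmCoord (lam : ℝ) (hlam : lam ≠ 0) (U : Cfg) :
    luscherPotential (zmCoord lam U) = luscherPotential (zmCoord 1 U) / lam ^ 4 := by
  have hc : ∀ i, colourVec (zmCoord lam U) i = lam⁻¹ • colourVec (zmCoord 1 U) i := fun i => by
    funext a; simp [colourVec, div_eq_mul_inv, mul_comm]
  unfold luscherPotential
  simp only [hc, map_smul, LinearMap.smul_apply, smul_dotProduct, dotProduct_smul, smul_eq_mul, ← Finset.mul_sum]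
  field_simp

/-- At the scale `lam` with `B lam³ = 2` (i.e. `lam = λ_b(B)`): the kernel's magnetic exponent `(B/2)·S(U)` equals
`8 lam · V(x)`, `x = zmCoord lam U` — linear in `lam`, exactly the `λ_b 𝔥` scaling of the zero-mode Hamiltonian. [cite: Luscher1983, §2] -/
theorem half_mul_wilsonAction_eq {B lam : ℝ} (hl : 0 < lam) (h3 : B * lam ^ 3 = 2) (U : Cfg) :
    B / 2 * wilsonAction su2Rep U = 8 * lam * luscherPotential (zmCoord lam U) := by
  rw [luscherPotential_zmCoord _ hl.ne' U, wilsonAction_one_site_eq_luscherPotential]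
  have h' : 8 * lam * (luscherPotential (zmCoord 1 U) / lam ^ 4) = 8 * luscherPotential (zmCoord 1 U) / lam ^ 3 := by
    rw [mul_div_assoc', div_eq_div_iff (pow_ne_zero 4 hl.ne') (pow_ne_zero 3 hl.ne')]
    ring
  rw [h', eq_div_iff (pow_ne_zero 3 hl.ne')]
  linear_combination (4 * luscherPotential (zmCoord 1 U)) * h3

/-- **Magnetic energy near the vacuum, via the exact identity**: `S(U) ≤ 3 t⁴` whenever every link has `vacDist ≤ t`
(from `|u_i|² ≤ vacDist(U_i)²/2` and `|u × v|² ≤ |u|²|v|²`) — twice sharper than the chain's `wilsonAction_le_of_vacDist`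
(`|P|·2t⁴ = 6t⁴`), same use in cut-off arguments. [folklore] -/
theorem wilsonAction_le_three_mul_pow (U : Cfg) {t : ℝ} (hU : ∀ e, vacDist (U e) ≤ t) :
    wilsonAction su2Rep U ≤ 3 * t ^ 4 := by
  have hcs : ∀ u v : Fin 3 → ℝ, (u ⨯₃ v) ⬝ᵥ (u ⨯₃ v) ≤ (∑ a, u a ^ 2) * (∑ a, v a ^ 2) := by
    intro u v
    simp only [cross_apply, dotProduct, Fin.sum_univ_three, Matrix.cons_val_zero, Matrix.cons_val_one, Matrix.head_cons,
      Matrix.cons_val_two, Matrix.tail_cons]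
    nlinarith [sq_nonneg (u 0 * v 0 + u 1 * v 1 + u 2 * v 2)]
  have hlink : ∀ e, ∑ a, vecPart (U e) a ^ 2 ≤ t ^ 2 / 2 := fun e =>
    (sum_vecPart_sq_le_vacDist_sq (U e)).trans (by
      have := pow_le_pow_left₀ (vacDist_nonneg _) (hU e) 2
      linarith)
  have hpair : ∀ i j, (vecPart (U (edgeOf i)) ⨯₃ vecPart (U (edgeOf j))) ⬝ᵥ (vecPart (U (edgeOf i)) ⨯₃ vecPart (U (edgeOf j)))
      ≤ t ^ 2 / 2 * (t ^ 2 / 2) := fun i j =>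
    (hcs _ _).trans (mul_le_mul (hlink _) (hlink _) (Finset.sum_nonneg fun a _ => sq_nonneg _) (by positivity))
  rw [wilsonAction_one_site_eq_luscherPotential]
  unfold luscherPotential
  have hc : ∀ k, colourVec (zmCoord 1 U) k = vecPart (U (edgeOf k)) := fun k => by
    rw [colourVec_zmCoord]; funext a; simp
  simp only [hc]
  have hdiag : ∀ i, (vecPart (U (edgeOf i)) ⨯₃ vecPart (U (edgeOf i))) ⬝ᵥ (vecPart (U (edgeOf i)) ⨯₃ vecPart (U (edgeOf i))) = 0 :=
    fun i => cross_dot_cross_self _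
  rw [Fin.sum_univ_three, Fin.sum_univ_three, Fin.sum_univ_three, Fin.sum_univ_three, hdiag, hdiag, hdiag]
  nlinarith [hpair 0 1, hpair 0 2, hpair 1 0, hpair 1 2, hpair 2 0, hpair 2 1]

/-! ### §5. The zero-mode chart `zmChart lam : ZM → Cfg`, local inverse of `zmCoord lam` -/

/-- `zmChart`-type maps are continuous: `x ↦ chartSU2 (lam · x_i)`. [folklore] -/
theorem continuous_chartSU2_comp (lam : ℝ) (i : Fin 3) : Continuous fun x : ZM => chartSU2 fun a => lam * x (i, a) := by
  refine continuous_chartSU2.comp (continuous_pi fun a => ?_)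
  exact continuous_const.mul ((PiLp.continuous_apply 2 _ (i, a)))

/-- The zero-mode chart: `x ∈ ℝ⁹ ↦ (chartSU2 (lam · x_i))_i`, the local inverse of `zmCoord lam`. [cite: Luscher1983, §2] -/
def zmChart (lam : ℝ) (x : ZM) : Cfg := fun e => chartSU2 fun a => lam * x (e.2, a)

/-- `zmCoord lam (zmChart lam x) = x` when every `|lam x_i| ≤ 1` (`lam ≠ 0`). [cite: Luscher1983, §2] -/
theorem zmCoord_zmChart {lam : ℝ} (hlam : lam ≠ 0) {x : ZM} (hx : ∀ i, ∑ a, (lam * x (i, a)) ^ 2 ≤ 1) :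
    zmCoord lam (zmChart lam x) = x := by
  ext p
  rw [zmCoord_apply]
  simp only [zmChart, edgeOf]
  rw [vecPart_chartSU2 (hx p.1), mul_div_cancel_left₀ _ hlam]

/-- `zmChart lam (zmCoord lam U) = U` when every link is in the hemisphere `u₀ ≥ 0` (`lam ≠ 0`). [cite: Luscher1983, §2] -/
theorem zmChart_zmCoord {lam : ℝ} (hlam : lam ≠ 0) {U : Cfg} (hU : ∀ e, 0 ≤ scalarPart (U e)) :
    zmChart lam (zmCoord lam U) = U := by
  funext e
  simp only [zmChart, zmCoord_apply]
  have h : (fun a => lam * (vecPart (U (edgeOf e.2)) a / lam)) = vecPart (U e) := by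
    funext a; rw [edgeOf_snd]; field_simp
  rw [h, chartSU2_vecPart _ (hU e)]

end Summit.QuantumFields.YangMills.Theorems.FemtoTransferGap

end
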